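import Literature.MathematicalPhysics.QuantumFieldTheory.Balaban1983to89.T4InputCauchyRateData

/-!
# OutputRateCount124 — the route-P1 END faces with the PRINTED-COUNT insertion constants `c = (6L)⁴`, `ω = L⁻¹` and the
# smallness S written out as an explicit bound on the one-run envelope `G`
# (cell `pub-balaban`, T⁴ fan-out, `HOME/BINDER-OWNERS.md` row NE5, owner lineage t4-ne5-p1, gen 31; owner ruling R30 (iii),
# journal l.12250; companion of the NE5-W3 × NE9-S5 junction `Support/InsertionChannelReading` of the O1-c holder)

HONEST FRAMING (T4-DAG PAGE 1).  Rung (B)+1 on ONE finite four-torus of fixed physical size — NOT infinite volume, NOT a mass gap, NOT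
the Clay problem; `FlowStep.BetaPertH`, (B), (B^μ) do not occur here.  NE5 (`T4OutputRate.NE5`) is NOT PRINTED ([Balaban1987RG1]–
[Balaban1989LargeFieldII] print ε-UNIFORM bounds, never η-RATES; cell GAPS G-t4-U3-1) and NOT PROVED (spine 0/9).  Nothing of Bałaban's
series is asserted; 0 cite tags; every printed locus below names the KIND of a displayed binder, never a hypothesis discharged here.
HONEST DEPENDENCY (cell, verbatim): continuum YM on T⁴ ⇐ BetaPertH ∧ nine spine estimates (0/9 proved); BetaPertH ⇐ (D1) ∧ (D4) ∧ CAP+tail;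
G-an2-4 gates asym, D1 and NE2/3/4.

WHY.  In the composition `T4InputCauchyRateData.StepModel.ne5_at_of_stepModel_lip_nat` (C1) the W3 binder `InsertionDampedNat W κ c ω`
(or its single-scale form `InsScaleBound W κ E₁ c ω`) carries two LETTERS: the newest-scale insertion weight `c` and the age damping `ω`,
and the route's SHARP smallness is `ω + Λ·c < θ′` (`T4InputCauchyRateSharp.sharp_ne5_iff`).  The O1-c holder's junction
(`InsertionChannelReading`, journal l.12240) reads W3 from row NE9's localisation-channel size binder with the pair made EXPLICIT from the
printed count of [II] p. 8 («This yields (6L)⁴Lʲη, and the sum over j is bounded by 2(6L)⁴» — KIND only): `c = (6L)⁴`, `ω = L⁻¹`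
(history-margin units).  This module states the END faces AT THOSE LETTERS and rewrites S as the explicit inequality
**`G < (θ′ − L⁻¹)·(1 − ρ₀)∕(6L)⁴`** on the one-run envelope `G` (W2) per history∕operator margin — so the census line «S symbolic»
acquires a visible L-power: the (1.24)-count costs `(6L)⁴` against the ε₁-smallness of the (2.41)-type level `G`.

WHAT THIS MODULE IS (bookkeeping/[folklore]; every END face concludes `T4OutputRate.NE5` LITERALLY):
* `smallness_count124_iff` — `L⁻¹ + Λ·(6L)⁴ < θ′ ↔ Λ < (θ′ − L⁻¹)∕(6L)⁴` and `smallnessG_count124_iff` — with `Λ = G∕(1 − ρ₀)`: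
  `L⁻¹ + G∕(1 − ρ₀)·(6L)⁴ < θ′ ↔ G < (θ′ − L⁻¹)(1 − ρ₀)∕(6L)⁴`;
* `inv_lt_rate_of_smallness_count124` — the target rate must exceed the age damping: `L⁻¹ < θ′` (for `0 ≤ Λ`);
* END faces `ne5_at_of_stepModel_lip_count124_nat` (C1 at `c = (6L)⁴, ω = L⁻¹`, smallness as the explicit Λ-bound) and
  `ne5_at_of_stepModel_fibre_count124_nat` (E1′: both fibre envelopes with constant `G`, smallness as the explicit G-bound).
STATUS (census, Edison rule).  Discharges NO wall; [analysis, not kernel]: with `G ~ O(1)C₃ε₁` ([II] (2.41) KIND) and the history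
margin the (1.36)-slack, S ⟸ «O(1)·C₃·ε₁·(6L)⁴ ≤ (θ′ − L⁻¹)(1 − ρ₀)·slack» — compatible with [II]'s ORDER of constants (ε₁ after L),
NOT a printed assumption ([II] p. 21 assumes only O(1)C₃ε₁ ≤ ½E₀).  NE5 NOT PROVED; 0/12 leaves on Bałaban's concrete objects; spine 0/9.
0 sorry; axioms ⊆ {propext, Classical.choice, Quot.sound}.
-/

noncomputable section

namespace Summit.QuantumFields.BalabanUV.T4Continuum.OutputRateCount124

open Literature.MathematicalPhysics.QuantumFieldTheory.Balaban1983to89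
open Literature.MathematicalPhysics.QuantumFieldTheory.Balaban1983to89.T4OutputRate
open Literature.MathematicalPhysics.QuantumFieldTheory.Balaban1983to89.T4InputCauchyRateData

/-! ## §1 The smallness S at the printed-count letters, written out -/

section Arithmetic

variable {L Λ G ρ₀ θ' : ℝ}

/-- `(6L)⁴ > 0` for `L > 0`. [folklore] -/
theorem count124_pos (hL : 0 < L) : 0 < (6 * L) ^ 4 := by positivity

/-- S at `c = (6L)⁴`, `ω = L⁻¹`: `L⁻¹ + Λ·(6L)⁴ < θ′ ↔ Λ < (θ′ − L⁻¹)∕(6L)⁴`. [folklore] -/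
theorem smallness_count124_iff (hL : 0 < L) :
    L⁻¹ + Λ * (6 * L) ^ 4 < θ' ↔ Λ < (θ' - L⁻¹) / (6 * L) ^ 4 := by
  rw [lt_div_iff₀ (count124_pos hL)]
  constructor <;> intro h <;> linarith

/-- S with the Cauchy modulus `Λ = G∕(1 − ρ₀)` of the fibre envelopes: `L⁻¹ + G∕(1 − ρ₀)·(6L)⁴ < θ′ ↔ G < (θ′ − L⁻¹)(1 − ρ₀)∕(6L)⁴`.
[folklore] -/
theorem smallnessG_count124_iff (hL : 0 < L) (hρ₀ : ρ₀ < 1) :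
    L⁻¹ + G / (1 - ρ₀) * (6 * L) ^ 4 < θ' ↔ G < (θ' - L⁻¹) * (1 - ρ₀) / (6 * L) ^ 4 := by
  have h1 : 0 < 1 - ρ₀ := by linarith
  rw [smallness_count124_iff hL, div_lt_iff₀ h1, div_mul_eq_mul_div]

/-- Under S at the printed-count letters the target rate exceeds the age damping: `L⁻¹ < θ′` (no rate at or below `L⁻¹` is
reachable on this route with `ω = L⁻¹`). [folklore] -/
theorem inv_lt_rate_of_smallness_count124 (hL : 0 < L) (hΛ : 0 ≤ Λ) (h : L⁻¹ + Λ * (6 * L) ^ 4 < θ') : L⁻¹ < θ' :=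
  lt_of_le_of_lt (le_add_of_nonneg_right (mul_nonneg hΛ (count124_pos hL).le)) h

end Arithmetic

/-! ## §2 END faces at `c = (6L)⁴`, `ω = L⁻¹` -/

section EndFaces

variable {C : Carriers} {Op Hist : Type*} [NormedAddCommGroup Op] [NormedSpace ℂ Op] [NormedAddCommGroup Hist]
  [NormedSpace ℂ Hist] (M : StepModel C Op Hist)

/-- **C1 AT THE PRINTED-COUNT LETTERS.**  `StepModel.ne5_at_of_stepModel_lip_nat` with the damped insertion read at `c = (6L)⁴`,
`ω = L⁻¹` (`1 < L`) and the smallness supplied as the explicit bound `Λ < (θ′ − L⁻¹)∕(6L)⁴` on the two-point Lipschitz modulus of W2;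
conclusion `NE5 EA EB W κ θ′ C₅` with C1's constant at those letters. [folklore] -/
theorem ne5_at_of_stepModel_lip_count124_nat {EA : Functional C C.BgA} {EB : Functional C C.BgB} {W : Set (ℕ → ℝ)}
    {L κ Λ EA₀ E₀ δ δ' θ θ' ρ₀ B : ℝ} {k₀ : ℕ} (hL : 1 < L) (hrA : M.RepresentsA EA W) (hrB : M.RepresentsB EB W)
    (hbase : M.InBase EB W) (hlip : M.DataLipschitz W κ Λ ρ₀) (hdA : DecayBound EA W EA₀ κ)
    (hdB : DecayBound EB W E₀ κ) (hop : M.OperatorRate W δ θ) (hins : M.InsertionRate W κ E₀ δ' θ)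
    (hdamp : M.InsertionDampedNat W κ ((6 * L) ^ 4) L⁻¹) (hΛ : 0 ≤ Λ) (hδ : 0 ≤ δ + δ') (hθ : 0 ≤ θ) (hθθ' : θ ≤ θ')
    (hθ'1 : θ' ≤ 1) (hnear : (δ + δ') * θ ^ k₀ + (6 * L) ^ 4 * (EA₀ + E₀) / (1 - L⁻¹) ≤ ρ₀)
    (hB : 0 ≤ B) (hfirst : ∀ k < k₀, EA₀ + E₀ ≤ B * θ ^ k) (hsmall : Λ < (θ' - L⁻¹) / (6 * L) ^ 4) :
    NE5 EA EB W κ θ' ((Λ * (δ + δ') + B) * (θ' - L⁻¹) / (θ' - (L⁻¹ + Λ * (6 * L) ^ 4))) :=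
  have hL0 : 0 < L := by linarith
  M.ne5_at_of_stepModel_lip_nat hrA hrB hbase hlip hdA hdB hop hins hdamp hΛ hδ hθ hθθ' hθ'1 (count124_pos hL0).le
    (inv_pos.2 hL0) hnear hB hfirst ((smallness_count124_iff hL0).2 hsmall)

/-- **E1′ AT THE PRINTED-COUNT LETTERS.**  `StepModel.ne5_at_of_stepModel_fibre_scale_nat` (both FIBRE envelopes with constant `G`,
the structural insertion shapes + the single-scale term `InsScaleBound κ E₁ (6L)⁴ L⁻¹`, the two rates) with the smallness supplied as
the explicit bound **`G < (θ′ − L⁻¹)(1 − ρ₀)∕(6L)⁴`** on the one-run envelope. [folklore] -/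
theorem ne5_at_of_stepModel_fibre_count124_nat {EA : Functional C C.BgA} {EB : Functional C C.BgB} {W : Set (ℕ → ℝ)}
    {L κ G EA₀ E₀ E₁ δ δ' θ θ' ρ₀ B : ℝ} {k₀ : ℕ} (hL : 1 < L) (hrA : M.RepresentsA EA W) (hrB : M.RepresentsB EB W)
    (hbase : M.InBase EB W) (hopF : M.OpFibreEnvelope W κ G) (hhistF : M.HistFibreEnvelope W κ G)
    (hdA : DecayBound EA W EA₀ κ) (hdB : DecayBound EB W E₀ κ) (hop : M.OperatorRate W δ θ)
    (hins : M.InsertionRate W κ E₀ δ' θ) (haff : M.InsAffine W) (hblind : M.InsBlind W) (hhom : M.InsHomog W)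
    (hunit : M.InsScaleBound W κ E₁ ((6 * L) ^ 4) L⁻¹) (hE₁ : 0 < E₁) (hG : 0 ≤ G) (hδ : 0 ≤ δ + δ') (hθ : 0 ≤ θ)
    (hθθ' : θ ≤ θ') (hθ'1 : θ' ≤ 1) (hρ₀ : ρ₀ < 1)
    (hnear : (δ + δ') * θ ^ k₀ + (6 * L) ^ 4 * (EA₀ + E₀) / (1 - L⁻¹) ≤ ρ₀) (hB : 0 ≤ B)
    (hfirst : ∀ k < k₀, EA₀ + E₀ ≤ B * θ ^ k) (hsmall : G < (θ' - L⁻¹) * (1 - ρ₀) / (6 * L) ^ 4) :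
    NE5 EA EB W κ θ'
      ((G / (1 - ρ₀) * (δ + δ') + B) * (θ' - L⁻¹) / (θ' - (L⁻¹ + G / (1 - ρ₀) * (6 * L) ^ 4))) :=
  have hL0 : 0 < L := by linarith
  M.ne5_at_of_stepModel_fibre_scale_nat hrA hrB hbase hopF hhistF hdA hdB hop hins haff hblind hhom hunit hE₁ hG hδ hθ hθθ'
    hθ'1 (count124_pos hL0).le (inv_pos.2 hL0) hρ₀ hnear hB hfirst ((smallnessG_count124_iff hL0 hρ₀).2 hsmall)

/-- Consequence displayed for the census: on this route, at the printed-count letters, any concluded rate satisfies `L⁻¹ < θ′`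
(read off the explicit smallness with `0 ≤ G`, `ρ₀ < 1`). [folklore] -/
theorem inv_lt_rate_of_smallnessG_count124 {L G ρ₀ θ' : ℝ} (hL : 1 < L) (hG : 0 ≤ G) (hρ₀ : ρ₀ < 1)
    (hsmall : G < (θ' - L⁻¹) * (1 - ρ₀) / (6 * L) ^ 4) : L⁻¹ < θ' :=
  have hL0 : 0 < L := by linarith
  inv_lt_rate_of_smallness_count124 hL0 (div_nonneg hG (by linarith))
    ((smallnessG_count124_iff hL0 hρ₀).2 hsmall)

end EndFaces

end Summit.QuantumFields.BalabanUV.T4Continuum.OutputRateCount124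

end
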